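import Mathlib
import Summits.ValiantsHypothesis.ValiantsHypothesis.Theorems.RigidityForcesSymmetryRankRigidMinimalReprLaplaceFiveStarLoneTerm

/-!
# ValiantsHypothesis / RigidityForcesSymmetry — crux `LaplaceOptimalFive` (stmt-ValiantsHypothesis-24813), crux idea
`young-shadow` (K1) on the star: **PROFILE REDUCTION — WEIGHT ≥ 120 UNLESS THREE SPLITS CARRY EXACTLY TWO TERMS**
(memo `NOTE-p4g15-24813-K1-star.md` §3 Cor. 3.2 / §6; memo `NOTE-p4g16-24813-LemmaK-kernel.md` §2 (L3-ii))

A side-symmetric pair decomposition of `P₅` supported on a star weighs `12·|T|`; if `|T| ≥ 10` it weighs `≥ 120`; a split carrying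
ONE term forces `≥ 120` (✓ `sideSym_starPairSplits_of_lone_term`); so a decomposition of weight `< 120` has `|T| ≤ 9` terms on four
splits, each carrying `≥ 2`, hence (counting) at least THREE splits carry EXACTLY TWO terms (`star_profile_reduction`) — the residual
profiles `(2,2,2,2)`, `(2,2,2,3)` that ✓ `two_term_split` feeds to LEMMA 2′.

No definitions, no `sorry`.  Honest framing: counting step of (L3); closes nothing; K1-on-the-star PAPER PASS, not kernel;
`LaplaceOptimalFive` OPEN · CONTESTED 72/120; `VP ≠ VNP` NOT proved.
-/

set_option linter.dupNamespace false

namespace Summit.ValiantsHypothesis.ValiantsHypothesis.Theorems.RigidityForcesSymmetryRankRigidMinimalRepr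

namespace LaplaceFiveStar

open Finset LaplaceFiveSectorSplit

variable {N : ℕ}

/-- A pair decomposition weighs `12 · |T|`. [folklore] -/
theorem laplaceWeight_pairs (T : Finset (Fin N)) (S : Fin N → Finset (Fin 5)) (hpair : ∀ t ∈ T, (S t).card = 2) :
    laplaceWeight T S = 12 * T.card := by
  unfold laplaceWeight
  rw [Finset.sum_congr rfl fun t ht => by rw [hpair t ht], Finset.sum_const, smul_eq_mul, mul_comm]
  norm_num [Nat.factorial]

/-- **Profile reduction on the star.**  Either the decomposition weighs `≥ 120`, or `|T| ≤ 9` and three distinct splits carry exactly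
two terms each. [folklore] -/
theorem star_profile_reduction (T : Finset (Fin N)) (S : Fin N → Finset (Fin 5))
    (u w : Fin N → (Fin 5 → Fin 5) → ℂ) (hdec : IsSplitDecomposition T S u w) (hsym : SideSymmetric T S u w)
    (hpair : ∀ t ∈ T, (S t).card = 2) (h4 : (T.image S).card = 4) (hstar : ∃ c : Fin 5, ∀ A ∈ T.image S, c ∈ A) :
    Nat.factorial 5 ≤ laplaceWeight T S ∨
    (T.card ≤ 9 ∧ ∃ A₁ A₂ A₃ : Finset (Fin 5), A₁ ∈ T.image S ∧ A₂ ∈ T.image S ∧ A₃ ∈ T.image S ∧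
      A₁ ≠ A₂ ∧ A₁ ≠ A₃ ∧ A₂ ≠ A₃ ∧
      (T.filter (fun t => S t = A₁)).card = 2 ∧ (T.filter (fun t => S t = A₂)).card = 2 ∧
      (T.filter (fun t => S t = A₃)).card = 2) := by
  classical
  have hW : laplaceWeight T S = 12 * T.card := laplaceWeight_pairs T S hpair
  by_cases hT : 10 ≤ T.card
  · left
    rw [hW]
    have : Nat.factorial 5 = 120 := by decide
    omega
  have hT9 : T.card ≤ 9 := by omega
  -- every split carries ≥ 2 terms, else the lone-term theorem applies
  by_cases hone : ∃ A ∈ T.image S, (T.filter (fun t => S t = A)).card = 1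
  · exact Or.inl (sideSym_starPairSplits_of_lone_term N T S u w hdec hsym hpair h4 hstar hone)
  right
  refine ⟨hT9, ?_⟩
  have hge1 : ∀ A ∈ T.image S, 1 ≤ (T.filter (fun t => S t = A)).card := by
    intro A hA
    obtain ⟨t, ht, rfl⟩ := Finset.mem_image.mp hA
    exact Finset.card_pos.mpr ⟨t, Finset.mem_filter.mpr ⟨ht, rfl⟩⟩
  have hge2 : ∀ A ∈ T.image S, 2 ≤ (T.filter (fun t => S t = A)).card := by
    intro A hA
    have h1 := hge1 A hA
    by_contra h
    exact hone ⟨A, hA, by omega⟩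
  -- `|T| = Σ_A n_A`
  have hsum : T.card = ∑ A ∈ T.image S, (T.filter (fun t => S t = A)).card :=
    Finset.card_eq_sum_card_fiberwise fun t ht => Finset.mem_image_of_mem S ht
  -- the splits with exactly two terms
  set B := (T.image S).filter (fun A => (T.filter (fun t => S t = A)).card = 2) with hB
  have hB3 : 3 ≤ B.card := by
    by_contra hlt
    have hle : B.card ≤ 2 := by omega
    -- Σ_A (n_A + [A ∈ B]) ≥ 12
    have key : ∀ A ∈ T.image S, 3 ≤ (T.filter (fun t => S t = A)).card + (if A ∈ B then 1 else 0) := by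
      intro A hA
      by_cases hAB : A ∈ B
      · rw [if_pos hAB]
        have := hge2 A hA
        omega
      · rw [if_neg hAB]
        have h2 := hge2 A hA
        have hne : (T.filter (fun t => S t = A)).card ≠ 2 := fun h => hAB (Finset.mem_filter.mpr ⟨hA, h⟩)
        omega
    have h12 : 12 ≤ ∑ A ∈ T.image S, ((T.filter (fun t => S t = A)).card + (if A ∈ B then 1 else 0)) := by
      calc 12 = ∑ _A ∈ T.image S, 3 := by rw [Finset.sum_const, smul_eq_mul, h4]
        _ ≤ _ := Finset.sum_le_sum key
    rw [Finset.sum_add_distrib, ← hsum, Finset.sum_boole] at h12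
    have hBc : ((T.image S).filter (fun A => A ∈ B)).card = B.card := by
      congr 1
      ext A
      simp only [Finset.mem_filter, hB]
      tauto
    simp only [Nat.cast_id] at h12
    rw [hBc] at h12
    omega
  obtain ⟨B', hB'B, hB'c⟩ := Finset.exists_subset_card_eq hB3
  obtain ⟨A₁, A₂, A₃, h12, h13, h23, hB'e⟩ := Finset.card_eq_three.mp hB'c
  have m1 : A₁ ∈ B := hB'B (by rw [hB'e]; simp)
  have m2 : A₂ ∈ B := hB'B (by rw [hB'e]; simp)
  have m3 : A₃ ∈ B := hB'B (by rw [hB'e]; simp)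
  rw [hB, Finset.mem_filter] at m1 m2 m3
  exact ⟨A₁, A₂, A₃, m1.1, m2.1, m3.1, h12, h13, h23, m1.2, m2.2, m3.2⟩

end LaplaceFiveStar

end Summit.ValiantsHypothesis.ValiantsHypothesis.Theorems.RigidityForcesSymmetryRankRigidMinimalRepr
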